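import Literature.Geometry.Lorentzian.WeightedNormsProofs
import Mathlib.Analysis.SpecialFunctions.JapaneseBracket
import HarnessLib

/-!
# Weighted Sobolev seminorms on `E3`: unions, null sets, majorants, tails of finite sizes, decay classes

Generic, fully proved bookkeeping for the tree's inhomogeneous `(1+r)`-weighted seminorms
`weightedSobolevSeminorm A s δ f` (`WeightedNorms`; Bartnik, CPAM 39 (1986), (1.2)–(1.3): the weighted
Sobolev spaces `W^{k,p}_δ` with weight `σ = (1+r²)^{1/2}`), valid for ANY `f` (no smoothness):

* §V0 `weightedSobolevSeminorm_union_le` (subadditivity in the set), `weightedSobolevSeminorm_of_null`,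
  `weightedSobolevSeminorm_le_of_majorant` (pointwise majorant ⇒ seminorm bound with an explicit
  integrable weight), `tendsto_setLIntegral_inter_tail` / `tendsto_weightedSobolevSeminorm_inter_tail`
  (the size of `U ∩ {R < r}` tends to `0` as `R → ∞` once the size on `U` is finite — absolute
  continuity of a finite integral), `weight_sq_le_of_decay`, `lintegral_japanese4_lt_top`
  (`∫ (1+|x|)^{-4} < ∞` on `ℝ³`), `weightedSobolevSeminorm_le_explicit`,
  `weightedSobolevSeminorm_lt_top_of_decay` (pointwise decay `‖Dᵐ F‖ ≤ |x|^{−(p+m)}` beyond `r` with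
  `2(δ − p) < −4`... gives a finite size);
* three elementary real-analysis rates used with them: `one_add_log_sq_le`
  (`(1 + log R)² ≤ 81 R^{1/4}`), `tendsto_zero_of_le_const_mul_rpow_neg`, `tendsto_rpow_half_ofReal_mul`.

Provenance: decomp-fsc lens-2 g37 side file `FamilySizeTendsto37.lean` §V0 (farm-checked there),
re-homed verbatim into `Literature.Geometry.Lorentzian` (tranche 3 of the cell's «ScaledAF» typing;
companions `WeightedNormsScaling`, `WeightedNormsAnnulus`); cites added.  NOT here: the scale-`R` zone
weights and the family-size limit (bT) of that file (route side).
-/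

noncomputable section

namespace Literature.Geometry.Lorentzian

open scoped ContDiff Topology ENNReal Pointwise
open Filter Set Function _root_.MeasureTheory Metric

section Tails

variable {G : Type*} [NormedAddCommGroup G] [NormedSpace ℝ G]

/-- Subadditivity in the SET (any `f`, any two sets): `∫⁻_{A ∪ B} ≤ ∫⁻_A + ∫⁻_B` order by order, then
`(a + b)^{1/2} ≤ a^{1/2} + b^{1/2}`. [cite: Bartnik1986, (1.3)] -/
theorem weightedSobolevSeminorm_union_le (A B : Set E3) (s : ℕ) (δ : ℝ) (f : E3 → G) :
    weightedSobolevSeminorm (A ∪ B) s δ f ≤ weightedSobolevSeminorm A s δ f + weightedSobolevSeminorm B s δ f := by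
  set Φ : ℕ → E3 → ℝ≥0∞ := fun m x ↦
    ENNReal.ofReal ((1 + ‖x‖) ^ (2 * (δ + m) : ℝ) * ‖iteratedFDeriv ℝ m f x‖ ^ 2) with hΦ
  unfold weightedSobolevSeminorm
  calc (∑ m ∈ Finset.range (s + 1), ∫⁻ x in A ∪ B, Φ m x) ^ (1 / 2 : ℝ)
      ≤ ((∑ m ∈ Finset.range (s + 1), ∫⁻ x in A, Φ m x) + ∑ m ∈ Finset.range (s + 1), ∫⁻ x in B, Φ m x) ^
          (1 / 2 : ℝ) := by
        rw [← Finset.sum_add_distrib]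
        exact ENNReal.rpow_le_rpow (Finset.sum_le_sum fun m _ ↦ lintegral_union_le _ A B) (by norm_num)
    _ ≤ _ := ENNReal.rpow_add_le_add_rpow _ _ (by norm_num) (by norm_num)

/-- A (Lebesgue-)NULL set carries no size (any `f`). [cite: Bartnik1986, (1.3)] -/
theorem weightedSobolevSeminorm_of_null {A : Set E3} (hA : volume A = 0) (s : ℕ) (δ : ℝ) (f : E3 → G) :
    weightedSobolevSeminorm A s δ f = 0 := by
  unfold weightedSobolevSeminorm
  rw [Measure.restrict_eq_zero.2 hA]
  simp only [lintegral_zero_measure, Finset.sum_const_zero]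
  exact ENNReal.zero_rpow_of_pos (by norm_num)

/-- MAJORANT ⇒ SIZE (any `f`, `A` measurable): if every weighted squared derivative size of order `≤ s` is at most
`a · φ` pointwise on `A` (`a ≥ 0` a constant), then `‖f‖_{Hˢ_δ(A)} ≤ ((s+1) a ∫⁻_A φ)^{1/2}`. [cite: Bartnik1986, (1.3)] -/
theorem weightedSobolevSeminorm_le_of_majorant {A : Set E3} (hA : MeasurableSet A) (f : E3 → G) {s : ℕ} {δ a : ℝ}
    (ha : 0 ≤ a) (φ : E3 → ℝ)
    (h : ∀ m ≤ s, ∀ x ∈ A, (1 + ‖x‖) ^ (2 * (δ + m) : ℝ) * ‖iteratedFDeriv ℝ m f x‖ ^ 2 ≤ a * φ x) :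
    weightedSobolevSeminorm A s δ f ≤
      (ENNReal.ofReal ((s + 1) * a) * ∫⁻ x in A, ENNReal.ofReal (φ x)) ^ (1 / 2 : ℝ) := by
  have hterm : ∀ m ∈ Finset.range (s + 1),
      ∫⁻ x in A, ENNReal.ofReal ((1 + ‖x‖) ^ (2 * (δ + m) : ℝ) * ‖iteratedFDeriv ℝ m f x‖ ^ 2) ≤
        ENNReal.ofReal a * ∫⁻ x in A, ENNReal.ofReal (φ x) := by
    intro m hm
    have hm' : m ≤ s := Nat.lt_succ_iff.mp (Finset.mem_range.mp hm)
    calc ∫⁻ x in A, ENNReal.ofReal ((1 + ‖x‖) ^ (2 * (δ + m) : ℝ) * ‖iteratedFDeriv ℝ m f x‖ ^ 2)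
        ≤ ∫⁻ x in A, ENNReal.ofReal a * ENNReal.ofReal (φ x) := by
          refine setLIntegral_mono' hA fun x hx ↦ ?_
          rw [← ENNReal.ofReal_mul ha]
          exact ENNReal.ofReal_le_ofReal (h m hm' x hx)
      _ = ENNReal.ofReal a * ∫⁻ x in A, ENNReal.ofReal (φ x) := lintegral_const_mul' _ _ ENNReal.ofReal_ne_top
  unfold weightedSobolevSeminorm
  refine ENNReal.rpow_le_rpow ((Finset.sum_le_sum hterm).trans_eq ?_) (by norm_num)
  rw [Finset.sum_const, Finset.card_range, nsmul_eq_mul, ← mul_assoc,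
    ENNReal.ofReal_mul (by positivity : (0 : ℝ) ≤ s + 1),
    show ((s : ℝ) + 1) = ((s + 1 : ℕ) : ℝ) by push_cast; ring, ENNReal.ofReal_natCast]

/-- TAIL OF A FINITE INTEGRAL (any `Φ`): `∫⁻_{U ∩ {ρ ≤ r}} Φ → 0` as `ρ → ∞` when `∫⁻_U Φ < ∞` (continuity from above of
the finite measure `(vol|_U).withDensity Φ` along the decreasing exteriors `{ρ ≤ ‖x‖}`, whose intersection is empty). [cite: Bartnik1986, (1.3)] -/
theorem tendsto_setLIntegral_inter_tail {U : Set E3} (Φ : E3 → ℝ≥0∞) (h : ∫⁻ x in U, Φ x ≠ ⊤) :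
    Tendsto (fun ρ : ℝ ↦ ∫⁻ x in U ∩ {x | ρ ≤ ‖x‖}, Φ x) atTop (𝓝 0) := by
  have hmeas : ∀ ρ : ℝ, MeasurableSet {x : E3 | ρ ≤ ‖x‖} := fun ρ ↦
    measurableSet_le measurable_const continuous_norm.measurable
  set ν : Measure E3 := (volume.restrict U).withDensity Φ with hν
  have happ : ∀ ρ : ℝ, ν {x | ρ ≤ ‖x‖} = ∫⁻ x in U ∩ {x | ρ ≤ ‖x‖}, Φ x := by
    intro ρ
    rw [hν, withDensity_apply _ (hmeas ρ), Measure.restrict_restrict (hmeas ρ), inter_comm]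
  have hanti : Antitone fun ρ : ℝ ↦ {x : E3 | ρ ≤ ‖x‖} := fun a b hab x hx ↦ le_trans hab hx
  have hint : ⋂ ρ : ℝ, {x : E3 | ρ ≤ ‖x‖} = ∅ := by
    refine Set.subset_empty_iff.1 fun x hx ↦ ?_
    have h1 : ‖x‖ + 1 ≤ ‖x‖ := Set.mem_iInter.1 hx (‖x‖ + 1)
    linarith
  have hfin : ∃ ρ : ℝ, ν {x | ρ ≤ ‖x‖} ≠ ⊤ :=
    ⟨0, by rw [happ]; exact ne_top_of_le_ne_top h (lintegral_mono_set inter_subset_left)⟩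
  have ht := tendsto_measure_iInter_atTop (μ := ν) (fun ρ ↦ (hmeas ρ).nullMeasurableSet) hanti hfin
  rw [hint, measure_empty] at ht
  exact ht.congr fun ρ ↦ happ ρ

/-- TAIL OF A FINITE SIZE (any `f`): `‖f‖_{Hˢ_δ(U ∩ {ρ ≤ r})} → 0` as `ρ → ∞` when `‖f‖_{Hˢ_δ(U)} < ∞`. [cite: Bartnik1986, (1.3)] -/
theorem tendsto_weightedSobolevSeminorm_inter_tail {U : Set E3} {s : ℕ} {δ : ℝ} {f : E3 → G}
    (h : weightedSobolevSeminorm U s δ f < ⊤) :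
    Tendsto (fun ρ : ℝ ↦ weightedSobolevSeminorm (U ∩ {x | ρ ≤ ‖x‖}) s δ f) atTop (𝓝 0) := by
  set Φ : ℕ → E3 → ℝ≥0∞ := fun m x ↦
    ENNReal.ofReal ((1 + ‖x‖) ^ (2 * (δ + m) : ℝ) * ‖iteratedFDeriv ℝ m f x‖ ^ 2) with hΦ
  unfold weightedSobolevSeminorm at h ⊢
  have hsum : ∑ m ∈ Finset.range (s + 1), ∫⁻ x in U, Φ m x < ⊤ :=
    (ENNReal.rpow_lt_top_iff_of_pos (by norm_num : (0 : ℝ) < 1 / 2)).1 h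
  have hm : ∀ m ∈ Finset.range (s + 1), ∫⁻ x in U, Φ m x ≠ ⊤ := fun m hm ↦
    (lt_of_le_of_lt (Finset.single_le_sum (f := fun m ↦ ∫⁻ x in U, Φ m x) (fun _ _ ↦ zero_le) hm) hsum).ne
  have hT : Tendsto (fun ρ : ℝ ↦ ∑ m ∈ Finset.range (s + 1), ∫⁻ x in U ∩ {x | ρ ≤ ‖x‖}, Φ m x) atTop (𝓝 0) := by
    have := tendsto_finsetSum (Finset.range (s + 1)) fun m hm' ↦ tendsto_setLIntegral_inter_tail (Φ m) (hm m hm')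
    rwa [Finset.sum_const_zero] at this
  have hc : Tendsto (fun z : ℝ≥0∞ ↦ z ^ (1 / 2 : ℝ)) (𝓝 0) (𝓝 0) := by
    have := (ENNReal.continuous_rpow_const (y := (1 / 2 : ℝ))).tendsto 0
    rwa [ENNReal.zero_rpow_of_pos (by norm_num)] at this
  exact hc.comp hT

/-- The one POINTWISE WEIGHT COMPUTATION behind every region (pure real arithmetic): a decay bound
`r^{j+n} t ≤ B` at radius `r ≥ ρ₀ > 0` gives `(1+r)^{2(δ+n)} t² ≤ B² κ^{2(j+s)} (1+r)^{2δ−2j}` for `n ≤ s`, with the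
inhomogeneity constant `κ = (1+ρ₀)/ρ₀ ≥ (1+r)/r`. [cite: Bartnik1986, (1.3)] -/
theorem weight_sq_le_of_decay {ρ₀ j δ B r t : ℝ} {n s : ℕ} (hρ₀ : 0 < ρ₀) (hj : 0 ≤ j) (hr : ρ₀ ≤ r)
    (hn : n ≤ s) (ht : 0 ≤ t) (hB : r ^ (j + n : ℝ) * t ≤ B) :
    (1 + r) ^ (2 * (δ + n) : ℝ) * t ^ 2 ≤
      B ^ 2 * ((1 + ρ₀) / ρ₀) ^ (2 * (j + s) : ℝ) * (1 + r) ^ (2 * δ - 2 * j : ℝ) := by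
  have hr0 : 0 < r := hρ₀.trans_le hr
  have h1r : 0 < 1 + r := by linarith
  have hκ1 : 1 ≤ (1 + ρ₀) / ρ₀ := by rw [le_div_iff₀ hρ₀]; linarith
  have hquot : (1 + r) / r ≤ (1 + ρ₀) / ρ₀ := by
    rw [div_le_div_iff₀ hr0 hρ₀]
    nlinarith
  have hQ : 0 < r ^ (j + n : ℝ) := Real.rpow_pos_of_pos hr0 _
  have hQne : r ^ (j + n : ℝ) ≠ 0 := hQ.ne'
  have htB : t ≤ B / r ^ (j + n : ℝ) := by
    rw [le_div_iff₀ hQ, mul_comm]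
    exact hB
  have hsplit : (1 + r) ^ (2 * (δ + n) : ℝ) = (1 + r) ^ (2 * δ - 2 * j : ℝ) * ((1 + r) ^ (j + n : ℝ)) ^ 2 := by
    rw [← Real.rpow_natCast ((1 + r) ^ (j + n : ℝ)) 2, ← Real.rpow_mul h1r.le, ← Real.rpow_add h1r]
    congr 1
    push_cast
    ring
  have hpow : ((1 + r) / r) ^ (j + n : ℝ) ≤ ((1 + ρ₀) / ρ₀) ^ (j + s : ℝ) :=
    calc ((1 + r) / r) ^ (j + n : ℝ) ≤ ((1 + ρ₀) / ρ₀) ^ (j + n : ℝ) :=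
          Real.rpow_le_rpow (by positivity) hquot (by positivity)
      _ ≤ ((1 + ρ₀) / ρ₀) ^ (j + s : ℝ) :=
          Real.rpow_le_rpow_of_exponent_le hκ1 (by simpa using (Nat.cast_le (α := ℝ)).2 hn)
  rw [hsplit]
  calc (1 + r) ^ (2 * δ - 2 * j : ℝ) * ((1 + r) ^ (j + n : ℝ)) ^ 2 * t ^ 2
      ≤ (1 + r) ^ (2 * δ - 2 * j : ℝ) * ((1 + r) ^ (j + n : ℝ)) ^ 2 * (B / r ^ (j + n : ℝ)) ^ 2 :=
        mul_le_mul_of_nonneg_left (pow_le_pow_left₀ ht htB 2) (by positivity)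
    _ = B ^ 2 * (((1 + r) / r) ^ (j + n : ℝ)) ^ 2 * (1 + r) ^ (2 * δ - 2 * j : ℝ) := by
        rw [Real.div_rpow h1r.le hr0.le]
        field_simp
    _ ≤ B ^ 2 * (((1 + ρ₀) / ρ₀) ^ (j + s : ℝ)) ^ 2 * (1 + r) ^ (2 * δ - 2 * j : ℝ) :=
        mul_le_mul_of_nonneg_right (mul_le_mul_of_nonneg_left (pow_le_pow_left₀ (by positivity) hpow 2)
          (sq_nonneg B)) (by positivity)
    _ = B ^ 2 * ((1 + ρ₀) / ρ₀) ^ (2 * (j + s) : ℝ) * (1 + r) ^ (2 * δ - 2 * j : ℝ) := by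
        rw [← Real.rpow_natCast (((1 + ρ₀) / ρ₀) ^ (j + s : ℝ)) 2, ← Real.rpow_mul (by positivity)]
        congr 2
        push_cast
        ring

/-- The Japanese-bracket integral `J₄ = ∫ (1+‖x‖)^{−4} dx < ∞` on `E3` (`4 > 3 = dim`). [cite: Bartnik1986, (1.2)] -/
theorem lintegral_japanese4_lt_top : ∫⁻ x : E3, ENNReal.ofReal ((1 + ‖x‖) ^ (-(4 : ℝ))) < ⊤ :=
  finite_integral_one_add_norm (by rw [finrank_euclideanSpace_fin]; norm_num)

/-- EXPLICIT SIZE BOUND from pointwise decay (any `f`, `A` measurable, `A ⊆ {ρ₀ ≤ r}`): decay `r^{j+n} ‖Dⁿf‖ ≤ B`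
(`n ≤ s`) on `A` and a uniform bound `(1+r)^{2δ−2j+4} ≤ W` on `A` give
`‖f‖_{Hˢ_δ(A)} ≤ ((s+1) B² κ^{2(j+s)} W · J₄)^{1/2}`, `κ = (1+ρ₀)/ρ₀`. [cite: Bartnik1986, (1.3)] -/
theorem weightedSobolevSeminorm_le_explicit {A : Set E3} (hA : MeasurableSet A) (f : E3 → G) {s : ℕ}
    {δ j ρ₀ B W : ℝ} (hρ₀ : 0 < ρ₀) (hj : 0 ≤ j) (hW : 0 ≤ W) (hAρ : ∀ x ∈ A, ρ₀ ≤ ‖x‖)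
    (hAW : ∀ x ∈ A, (1 + ‖x‖) ^ (2 * δ - 2 * j + 4 : ℝ) ≤ W)
    (h : ∀ n ≤ s, ∀ x ∈ A, ‖x‖ ^ (j + n : ℝ) * ‖iteratedFDeriv ℝ n f x‖ ≤ B) :
    weightedSobolevSeminorm A s δ f ≤
      (ENNReal.ofReal ((s + 1) * (B ^ 2 * ((1 + ρ₀) / ρ₀) ^ (2 * (j + s) : ℝ) * W)) *
        ∫⁻ x : E3, ENNReal.ofReal ((1 + ‖x‖) ^ (-(4 : ℝ)))) ^ (1 / 2 : ℝ) := by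
  refine (weightedSobolevSeminorm_le_of_majorant hA f (by positivity) (fun x ↦ (1 + ‖x‖) ^ (-(4 : ℝ)))
    fun n hn x hx ↦ ?_).trans (ENNReal.rpow_le_rpow (mul_le_mul_right (setLIntegral_le_lintegral _ _) _)
      (by norm_num))
  have h1x : 0 < 1 + ‖x‖ := by positivity
  refine (weight_sq_le_of_decay hρ₀ hj (hAρ x hx) hn (norm_nonneg _) (h n hn x hx)).trans ?_
  rw [show (2 * δ - 2 * j : ℝ) = (2 * δ - 2 * j + 4) + (-(4 : ℝ)) by ring, Real.rpow_add h1x, ← mul_assoc]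
  exact mul_le_mul_of_nonneg_right (mul_le_mul_of_nonneg_left (hAW x hx) (by positivity)) (by positivity)

/-- FINITE SIZE from a POINTWISE CLASS (any `F`): `‖Dᵐ F (x)‖ ≤ ‖x‖^{−p−m}` (`m ≤ s`) beyond `r ≥ 1` and
`2δ − 2p < −3` give `‖F‖_{Hˢ_δ({r < ‖x‖})} < ∞` (majorant `(1+‖x‖)^{2δ−2p}`, Japanese bracket). Serves the two
reference classes of `IsStronglyAsymptoticallyFlatWith d₀ M (1+γ') (2+γ') 13 12` in the LO weights `γ ∓ 1/2`. [cite: Bartnik1986, (1.3)] -/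
theorem weightedSobolevSeminorm_lt_top_of_decay (F : E3 → G) {s : ℕ} {δ p r : ℝ} (hr : 1 ≤ r) (hp : 0 ≤ p)
    (hδp : 2 * δ - 2 * p < -3)
    (hF : ∀ m ≤ s, ∀ x : E3, r < ‖x‖ → ‖iteratedFDeriv ℝ m F x‖ ≤ ‖x‖ ^ (-p - m : ℝ)) :
    weightedSobolevSeminorm {x : E3 | r < ‖x‖} s δ F < ⊤ := by
  have hA : MeasurableSet {x : E3 | r < ‖x‖} := measurableSet_lt measurable_const continuous_norm.measurable
  have hJ : ∫⁻ x : E3, ENNReal.ofReal ((1 + ‖x‖) ^ (2 * δ - 2 * p : ℝ)) < ⊤ := by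
    rw [show (2 * δ - 2 * p : ℝ) = -(2 * p - 2 * δ) by ring]
    exact finite_integral_one_add_norm (by rw [finrank_euclideanSpace_fin]; push_cast; linarith)
  refine lt_of_le_of_lt (weightedSobolevSeminorm_le_of_majorant hA F (s := s) (δ := δ)
    (a := ((1 + 1) / 1) ^ (2 * (p + s) : ℝ)) (by positivity) (fun x ↦ (1 + ‖x‖) ^ (2 * δ - 2 * p : ℝ))
    fun m hm x hx ↦ ?_) ?_
  · have hx1 : (1 : ℝ) ≤ ‖x‖ := hr.trans (le_of_lt hx)
    have hx0 : 0 < ‖x‖ := by linarith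
    have hB : ‖x‖ ^ (p + m : ℝ) * ‖iteratedFDeriv ℝ m F x‖ ≤ 1 := by
      calc ‖x‖ ^ (p + m : ℝ) * ‖iteratedFDeriv ℝ m F x‖ ≤ ‖x‖ ^ (p + m : ℝ) * ‖x‖ ^ (-p - m : ℝ) :=
            mul_le_mul_of_nonneg_left (hF m hm x hx) (by positivity)
        _ = 1 := by rw [← Real.rpow_add hx0, show (p + m + (-p - m) : ℝ) = 0 by ring, Real.rpow_zero]
    simpa only [one_pow, one_mul] using weight_sq_le_of_decay one_pos hp hx1 hm (norm_nonneg _) hB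
  · refine ENNReal.rpow_lt_top_of_nonneg (by norm_num) (ENNReal.mul_ne_top ENNReal.ofReal_ne_top ?_)
    exact (lt_of_le_of_lt (setLIntegral_le_lintegral _ _) hJ).ne

/-- `log R ≤ 8 R^{1/8}`, so `(1 + log R)² ≤ 81 R^{1/4}` for `R ≥ 1` (the `log` loss of MOT's bounds is harmless). [cite: MaoOhTao2023, Def. 1.5 (rate bookkeeping for the scaled sizes)] -/
theorem one_add_log_sq_le {R : ℝ} (hR : 1 ≤ R) : (1 + Real.log R) ^ 2 ≤ 81 * R ^ (1 / 4 : ℝ) := by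
  have hR0 : 0 ≤ R := by linarith
  have h8 : Real.log R ≤ 8 * R ^ (1 / 8 : ℝ) := by
    have := Real.log_le_rpow_div hR0 (by norm_num : (0 : ℝ) < 1 / 8)
    linarith [this]
  have h1 : (1 : ℝ) ≤ R ^ (1 / 8 : ℝ) := Real.one_le_rpow hR (by norm_num)
  have hl0 : 0 ≤ 1 + Real.log R := by linarith [Real.log_nonneg hR]
  have h9 : 1 + Real.log R ≤ 9 * R ^ (1 / 8 : ℝ) := by linarith
  calc (1 + Real.log R) ^ 2 ≤ (9 * R ^ (1 / 8 : ℝ)) ^ 2 := pow_le_pow_left₀ hl0 h9 2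
    _ = 81 * R ^ (1 / 4 : ℝ) := by
        rw [mul_pow, ← Real.rpow_natCast (R ^ (1 / 8 : ℝ)) 2, ← Real.rpow_mul hR0]
        norm_num

/-- Real squeeze: `0 ≤ a R ≤ A R^{−y}` (`y > 0`) beyond `R₀` forces `a R → 0`. [cite: MaoOhTao2023, Def. 1.5 (rate bookkeeping for the scaled sizes)] -/
theorem tendsto_zero_of_le_const_mul_rpow_neg {a : ℝ → ℝ} {A y R₀ : ℝ} (hy : 0 < y) (h0 : ∀ R, R₀ ≤ R → 0 ≤ a R)
    (h : ∀ R, R₀ ≤ R → a R ≤ A * R ^ (-y)) : Tendsto a atTop (𝓝 0) := by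
  have hA : Tendsto (fun R : ℝ ↦ A * R ^ (-y)) atTop (𝓝 0) := by
    simpa only [mul_zero] using (tendsto_rpow_neg_atTop hy).const_mul A
  exact tendsto_of_tendsto_of_tendsto_of_le_of_le' tendsto_const_nhds hA
    (eventually_atTop.2 ⟨R₀, h0⟩) (eventually_atTop.2 ⟨R₀, h⟩)

/-- ENNReal squeeze shape of the explicit bounds: `(ofReal (a R) · J)^{1/2} → 0` when `a R → 0` and `J < ∞`. [cite: MaoOhTao2023, Def. 1.5 (rate bookkeeping for the scaled sizes)] -/
theorem tendsto_rpow_half_ofReal_mul {a : ℝ → ℝ} (ha : Tendsto a atTop (𝓝 0)) {J : ℝ≥0∞} (hJ : J ≠ ⊤) :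
    Tendsto (fun R : ℝ ↦ (ENNReal.ofReal (a R) * J) ^ (1 / 2 : ℝ)) atTop (𝓝 0) := by
  have h1 : Tendsto (fun R : ℝ ↦ ENNReal.ofReal (a R) * J) atTop (𝓝 0) := by
    have := ENNReal.Tendsto.mul_const (ENNReal.tendsto_ofReal ha) (Or.inr hJ)
    rwa [ENNReal.ofReal_zero, zero_mul] at this
  have hc : Tendsto (fun z : ℝ≥0∞ ↦ z ^ (1 / 2 : ℝ)) (𝓝 0) (𝓝 0) := by
    have := (ENNReal.continuous_rpow_const (y := (1 / 2 : ℝ))).tendsto 0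
    rwa [ENNReal.zero_rpow_of_pos (by norm_num)] at this
  exact hc.comp h1

end Tails

/-! ## Monotonicity of the weighted Sobolev currency in the exponents `(s, δ)` -/

open scoped Manifold

section Exponents

variable {F G : Type*} [NormedAddCommGroup F] [NormedSpace ℝ F] [NormedAddCommGroup G]
  [NormedSpace ℝ G] [MeasureSpace F]

/-- **The weighted Sobolev seminorm is monotone in the exponents**: for `s ≤ s'` and `δ ≤ δ'`,
`‖f‖_{H^s_δ(U)} ≤ ‖f‖_{H^{s'}_{δ'}(U)}` (more derivatives are summed and, since `1 + ‖x‖ ≥ 1`, the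
weights `(1 + ‖x‖)^{2(δ+m)}` increase with `δ`).  Bartnik, CPAM 39 (1986), (1.2) (the scale
`W^{k,p}_δ` is nested in `k` and in the weight). [cite: Bartnik1986, (1.2)] -/
theorem weightedSobolevSeminorm_mono_exponents (U : Set F) {s s' : ℕ} (hs : s ≤ s') {δ δ' : ℝ}
    (hδ : δ ≤ δ') (f : F → G) :
    weightedSobolevSeminorm U s δ f ≤ weightedSobolevSeminorm U s' δ' f := by
  unfold weightedSobolevSeminorm
  refine ENNReal.rpow_le_rpow ?_ (by norm_num)
  calc ∑ m ∈ Finset.range (s + 1), ∫⁻ x in U,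
          ENNReal.ofReal ((1 + ‖x‖) ^ (2 * (δ + m) : ℝ) * ‖iteratedFDeriv ℝ m f x‖ ^ 2)
      ≤ ∑ m ∈ Finset.range (s + 1), ∫⁻ x in U,
          ENNReal.ofReal ((1 + ‖x‖) ^ (2 * (δ' + m) : ℝ) * ‖iteratedFDeriv ℝ m f x‖ ^ 2) := by
        refine Finset.sum_le_sum fun m _ ↦ lintegral_mono fun x ↦ ENNReal.ofReal_le_ofReal ?_
        refine mul_le_mul_of_nonneg_right ?_ (sq_nonneg _)
        exact Real.rpow_le_rpow_of_exponent_le (by linarith [norm_nonneg x]) (by linarith)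
    _ ≤ ∑ m ∈ Finset.range (s' + 1), ∫⁻ x in U,
          ENNReal.ofReal ((1 + ‖x‖) ^ (2 * (δ' + m) : ℝ) * ‖iteratedFDeriv ℝ m f x‖ ^ 2) :=
        Finset.sum_le_sum_of_subset_of_nonneg (Finset.range_mono (show s + 1 ≤ s' + 1 by omega))
          fun _ _ _ ↦ zero_le

end Exponents

/-- **The weighted Sobolev distance of initial data sets is monotone in `(s, δ)`**: for `s ≤ s'`
and `δ ≤ δ'`, `dist_{s,δ}(D₁, D₂) ≤ dist_{s',δ'}(D₁, D₂)` (both the `h`-part in `H^s_δ` and the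
`k`-part in `H^{s-1}_{δ+1}`); e.g. `dist₃,₋₁ ≤ dist₁₂,₋₃/₄`, so an `H¹²₋₃/₄`-ball lies in the
`H³₋₁`-ball of the same radius.  Bartnik 1986, (1.2); Christodoulou–Klainerman 1993, (1.0.9).
[cite: Bartnik1986, (1.2)] -/
theorem InitialDataSet.dataWeightedSobolevEDist_mono_exponents {U : TopologicalSpace.Opens E3}
    {s s' : ℕ} (hs : s ≤ s') {δ δ' : ℝ} (hδ : δ ≤ δ') (D₁ D₂ : InitialDataSet 𝓘(ℝ, E3) U) :
    InitialDataSet.dataWeightedSobolevEDist s δ D₁ D₂ ≤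
      InitialDataSet.dataWeightedSobolevEDist s' δ' D₁ D₂ := by
  unfold InitialDataSet.dataWeightedSobolevEDist
  exact add_le_add (weightedSobolevSeminorm_mono_exponents _ hs hδ _)
    (weightedSobolevSeminorm_mono_exponents _ (Nat.sub_le_sub_right hs 1) (by linarith) _)

/-- The instance used by the decomp-fsc stability cells: the `H¹²₋₃/₄` distance to any reference
data dominates the `H³₋₁` distance (`3 ≤ 12`, `−1 ≤ −3/4`). Bartnik 1986, (1.2). [cite: Bartnik1986, (1.2)] -/
theorem InitialDataSet.dataWeightedSobolevEDist_three_negOne_le {U : TopologicalSpace.Opens E3}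
    (D₁ D₂ : InitialDataSet 𝓘(ℝ, E3) U) :
    InitialDataSet.dataWeightedSobolevEDist 3 (-1) D₁ D₂ ≤
      InitialDataSet.dataWeightedSobolevEDist 12 (-3 / 4) D₁ D₂ :=
  InitialDataSet.dataWeightedSobolevEDist_mono_exponents (by norm_num) (by norm_num) D₁ D₂

end Literature.Geometry.Lorentzian

end
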